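import Mathlib

/-!
# The slice certificates of the typed `K₃` base on `K₅ + a₃` of degree 3 — the definitions, parametrised by the attachment triple `(x, y, z)`
(blind cell PercRepro2, mine-2 g27; the degree-3 rung of `PMK5Deg2Kernel.lean` (mine-2 g26, Theorem 27); census
M2-63, kit j260972, two own codes digit for digit: 0 negative class sums among 10 × 4^13)

The graph: `K₅` on `o = 0, a₁ = 1, a₂ = 2, u = 3, b = 4` (edges `0..9`, lexicographic pairs) plus the vertex
`a₃ = 5` joined to `x` (edge `10`), to `y` (edge `11`) and to `z` (edge `12`), `x, y, z : Fin 5` the parameters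
of the family (the ten triples `x < y < z` are the ten degree-3 attachments of M2-63).  Configurations
`ω : Fin 13 → Bool`; connectivity on vertex bitmasks (`nb`, `step`, `reach` — five closure steps on six
vertices — `conn`), all kernel-accelerated.  The marks of the crux functional are `o = 0, a₁ = 1, a₂ = 2,
a₃ = 5, b = 4`; p1's eight-term kernel `K₃` splits on `Q = {a₁ ↮ a₂}` into ten positive and ten negative
products of three `0/1` tables exactly as in `K5K3Kernel.lean` / `PMK5Deg2Kernel.lean` (`tab`: the nineteen tables).

**Why slices.** One Kronecker certificate over all `4^13` profiles (numbers of `200` MB) does not fit the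
kernel's memory wall on the farm (the kernel retains every intermediate literal and every cached reduction).
So the profile space is SLICED by the digits `(j₁, j₂)` of the two `a₃`-edges `11`, `12`: a profile
`k : Fin 13 → Fin 4` is `(k', j₁, j₂)` with `k'` on the eleven remaining edges, and the class sum at `k` is the
sum, over the three-bit splittings `(a, b, c)` of `j₁` and `(a', b', c')` of `j₂` (`splits3`, `pairs2`), of the
eleven-edge triple counts of the tables restricted to edges `11 ↦ ·`, `12 ↦ ·` (`res2`, `ext2`; proved in
`Deg3Slices.lean`).  Each slice is a `4^11`-digit certificate (`kPosS`, `kNegS`, `CertS`; numbers of `12.5` MB),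
the products grouped by the first factor (`brPosPD`, …) to keep few large intermediates.

**Table literals.** The kernel would also choke on evaluating the connectivity tables at every leaf of every
restricted Kronecker number (cached reductions).  So the restricted tables enter the slice numbers as BIT-VECTOR
LITERALS `L : Fin 19 → Bool → Bool → ℕ` (`2048` bits each, `KL`, `kronL` / `goL` — the index-carrying tree whose
leaves are single `Nat.testBit`s), and a separate kernel theorem per restriction certifies the literals against
the tables (`LitOK`, `bits11` / `goB` — the bit-vector tree).  A triple's certificate is `LitOK x y z L` plus
`Cert L` (the sixteen `CertS L j₁ j₂`); `Deg3Typed.HCov_deg3` turns it into row 2′TRI and (HCOV) on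
`K₅ + {a₃x, a₃y, a₃z}` for every weight vector.

**Kronecker substitution** (eleven edges): `kron T = Σ_ω [T ω] · KB^{idx ω}`, `idx ω = Σ_e ω_e 4^e`, `KB = 2^24`;
a product of three encodings carries, digit by digit, the typed three-copy class sums (`Deg3Kron.kronSum_mul_mul`);
a slice digit is a sum of at most `90` counts, each `≤ 3^11`, so `< 90 · 3^11 = 15,943,230 < 2^24 = KB`.
**The certificate** (`CertS`): `kNegS ≤ kPosS`, `Nat.land (kPosS − kNegS) mask = 0`, `Nat.land kNegS mask = 0`
(`mask` = bit `23` of every base-`KB` digit below `4^11`): the digits of `kNegS` and of the difference are below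
`2^23`, so the subtraction borrowed nowhere — `kPosS ≥ kNegS` DIGITWISE (`Deg3Digits.le_of_kron_le'`).
No `native_decide`, no data file beyond the table literals, which the kernel itself certifies.
-/

namespace Summit.Ventures.PercRepro2

namespace Deg3

/-! ## The graph `K₅ + {a₃x, a₃y, a₃z}` and bitmask connectivity on six vertices -/

/-- First endpoint of edge `e` (lexicographic pairs of `K₅`, then `a₃x`, `a₃y`, `a₃z`: the attachment triple
`x, y, z : Fin 5` is the parameter of the family). -/
def ea (x y z : Fin 5) : Fin 13 → ℕ
  | 0 => 0 | 1 => 0 | 2 => 0 | 3 => 0 | 4 => 1 | 5 => 1 | 6 => 1 | 7 => 2 | 8 => 2 | 9 => 3 | 10 => x | 11 => y | 12 => z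

/-- Second endpoint of edge `e` (the three attachment edges end at `a₃ = 5`). -/
def eb : Fin 13 → ℕ
  | 0 => 1 | 1 => 2 | 2 => 3 | 3 => 4 | 4 => 2 | 5 => 3 | 6 => 4 | 7 => 3 | 8 => 4 | 9 => 4 | 10 => 5 | 11 => 5 | 12 => 5

/-- The neighbour bitmask of the vertex `u` in the open subgraph of `ω`. -/
def nb (x y z : Fin 5) (ω : Fin 13 → Bool) (u : ℕ) : ℕ :=
  (List.finRange 13).foldl (fun acc e =>
    if ω e then
      (if ea x y z e = u then acc ||| (1 <<< eb e) else if eb e = u then acc ||| (1 <<< ea x y z e) else acc)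
    else acc) 0

/-- One closure step on a vertex bitmask: add the open neighbours of every vertex of `R`. -/
def step (x y z : Fin 5) (ω : Fin 13 → Bool) (R : ℕ) : ℕ :=
  (List.range 6).foldl (fun acc v => if R.testBit v then acc ||| nb x y z ω v else acc) R

/-- The vertices reached from `u` (five steps suffice on six vertices). -/
def reach (x y z : Fin 5) (ω : Fin 13 → Bool) (u : ℕ) : ℕ :=
  step x y z ω (step x y z ω (step x y z ω (step x y z ω (step x y z ω (1 <<< u)))))

/-- Computable connectivity `u ↔ v` in the open subgraph of `ω`. -/
def conn (x y z : Fin 5) (ω : Fin 13 → Bool) (u v : ℕ) : Bool := (reach x y z ω u).testBit v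

/-! ## The side tables (marks `o = 0, a₁ = 1, a₂ = 2, a₃ = 5, b = 4`) -/

/-- `Q = {a₁ ↮ a₂}`. -/
def tQ (x y z : Fin 5) (ω : Fin 13 → Bool) : Bool := !conn x y z ω 1 2
/-- `L_v = {v ∈ C₁}`: `v` joined to `a₁ = 1`. -/
def tL (x y z : Fin 5) (v : ℕ) (ω : Fin 13 → Bool) : Bool := conn x y z ω 1 v
/-- `H_v = {v ∈ C₂}`: `v` joined to `a₂ = 2`. -/
def tH (x y z : Fin 5) (v : ℕ) (ω : Fin 13 → Bool) : Bool := conn x y z ω 2 v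
/-- `U_v = {v ∈ C₁ ∪ C₂}`. -/
def tU (x y z : Fin 5) (v : ℕ) (ω : Fin 13 → Bool) : Bool := tL x y z v ω || tH x y z v ω
/-- `u` and `v` on the same side: the positive part of `σ_u σ_v`. -/
def tSame (x y z : Fin 5) (u v : ℕ) (ω : Fin 13 → Bool) : Bool :=
  (tL x y z u ω && tL x y z v ω) || (tH x y z u ω && tH x y z v ω)
/-- `u` and `v` on opposite sides: the negative part of `σ_u σ_v`. -/
def tOpp (x y z : Fin 5) (u v : ℕ) (ω : Fin 13 → Bool) : Bool :=
  (tL x y z u ω && tH x y z v ω) || (tH x y z u ω && tL x y z v ω)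
/-- `PD = Q ∩ {a₃ ∉ C₁ ∪ C₂}`. -/
def tPD (x y z : Fin 5) (ω : Fin 13 → Bool) : Bool := tQ x y z ω && !tL x y z 5 ω && !tH x y z 5 ω
/-- `PD ∩ {o ∈ C₁ ∪ C₂}` (`f₃`). -/
def tPDoU (x y z : Fin 5) (ω : Fin 13 → Bool) : Bool := tPD x y z ω && tU x y z 0 ω

/-! ## The tables of the twelve functions -/

/-- `f₄⁺ = 1_Q 1_{o, b same side}`. -/
def t4p (x y z : Fin 5) (ω : Fin 13 → Bool) : Bool := tQ x y z ω && tSame x y z 0 4 ω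
/-- `f₄⁻ = 1_Q 1_{o, b opposite}`. -/
def t4m (x y z : Fin 5) (ω : Fin 13 → Bool) : Bool := tQ x y z ω && tOpp x y z 0 4 ω
/-- `f₅⁺ = 1_Q 1_{a₃, b same side}`. -/
def t5p (x y z : Fin 5) (ω : Fin 13 → Bool) : Bool := tQ x y z ω && tSame x y z 5 4 ω
/-- `f₅⁻ = 1_Q 1_{a₃, b opposite}`. -/
def t5m (x y z : Fin 5) (ω : Fin 13 → Bool) : Bool := tQ x y z ω && tOpp x y z 5 4 ω
/-- `f₆⁺ = 1_Q 1_{o∈U} 1_{a₃, b same side}`. -/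
def t6p (x y z : Fin 5) (ω : Fin 13 → Bool) : Bool := tQ x y z ω && tU x y z 0 ω && tSame x y z 5 4 ω
/-- `f₆⁻ = 1_Q 1_{o∈U} 1_{a₃, b opposite}`. -/
def t6m (x y z : Fin 5) (ω : Fin 13 → Bool) : Bool := tQ x y z ω && tU x y z 0 ω && tOpp x y z 5 4 ω
/-- `f₇⁺` at `v`: `1_Q 1_{v∈C₁}` (`f₇` at `b = 4`, `f₈` at `o = 0`, `f₉` at `a₃ = 5`). -/
def t7p (x y z : Fin 5) (v : ℕ) (ω : Fin 13 → Bool) : Bool := tQ x y z ω && tL x y z v ω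
/-- `f₇⁻` at `v`: `1_Q 1_{v∈C₂}`. -/
def t7m (x y z : Fin 5) (v : ℕ) (ω : Fin 13 → Bool) : Bool := tQ x y z ω && tH x y z v ω
/-- `f₁₀⁺ = 1_Q 1_{a₃∈C₁} 1_{o∈U}`. -/
def t10p (x y z : Fin 5) (ω : Fin 13 → Bool) : Bool := tQ x y z ω && tL x y z 5 ω && tU x y z 0 ω
/-- `f₁₀⁻ = 1_Q 1_{a₃∈C₂} 1_{o∈U}`. -/
def t10m (x y z : Fin 5) (ω : Fin 13 → Bool) : Bool := tQ x y z ω && tH x y z 5 ω && tU x y z 0 ω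
/-- `f₁₁ = 1_PD 1_{o∈U} 1_{b∈U}`. -/
def t11 (x y z : Fin 5) (ω : Fin 13 → Bool) : Bool := tPD x y z ω && tU x y z 0 ω && tU x y z 4 ω
/-- `f₁₂ = 1_PD 1_{b∈U}`. -/
def t12 (x y z : Fin 5) (ω : Fin 13 → Bool) : Bool := tPD x y z ω && tU x y z 4 ω

/-! ## The nineteen tables as a family -/

/-- The nineteen `0/1` tables of the split kernel, indexed: `0 Q, 1 PD, 2 PDoU, 3 t4p, 4 t4m, 5 t5p, 6 t5m, 7 t6p,
8 t6m, 9 t7p4, 10 t7m4, 11 t7p0, 12 t7m0, 13 t7p5, 14 t7m5, 15 t10p, 16 t10m, 17 t11, 18 t12`. -/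
def tab (x y z : Fin 5) : Fin 19 → (Fin 13 → Bool) → Bool :=
  ![tQ x y z, tPD x y z, tPDoU x y z, t4p x y z, t4m x y z, t5p x y z, t5m x y z, t6p x y z, t6m x y z,
    t7p x y z 4, t7m x y z 4, t7p x y z 0, t7m x y z 0, t7p x y z 5, t7m x y z 5, t10p x y z, t10m x y z,
    t11 x y z, t12 x y z]

/-! ## Restriction of the two `a₃`-edges `11`, `12`: tables on the eleven remaining edges -/

/-- Extend an eleven-edge configuration by the states `a` of edge `11` and `b` of edge `12`. -/
def ext2 (ω : Fin 11 → Bool) (a b : Bool) : Fin 13 → Bool :=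
  fun e => if h : (e : ℕ) < 11 then ω ⟨e, h⟩ else if (e : ℕ) = 11 then a else b

/-- The restriction of a thirteen-edge table to the eleven-edge configurations, edges `11`, `12` fixed. -/
def res2 (T : (Fin 13 → Bool) → Bool) (a b : Bool) : (Fin 11 → Bool) → Bool := fun ω => T (ext2 ω a b)

/-! ## Bit vectors of eleven-edge tables (the certificate's table literals) -/

/-- The binary index of an eleven-edge configuration: bit `e` is the state of edge `e`. -/
def idx2 (ω : Fin 11 → Bool) : ℕ := ∑ e, (ω e).toNat * 2 ^ (e : ℕ)

/-- The bit vector of a table, as a finite sum: bit `idx2 ω` is `T ω`. -/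
def bitsSum (T : (Fin 11 → Bool) → Bool) : ℕ := ∑ ω, (T ω).toNat * 2 ^ idx2 ω

/-- The same by the edge tree (`goB T n ω` over the states of the edges `< n`, the others fixed by `ω`). -/
def goB (T : (Fin 11 → Bool) → Bool) : ℕ → (Fin 11 → Bool) → ℕ
  | 0, ω => (T ω).toNat
  | n + 1, ω => goB T n (Function.update ω (Fin.ofNat 11 n) false) +
      2 ^ (2 ^ n) * goB T n (Function.update ω (Fin.ofNat 11 n) true)

/-- The bit vector of an eleven-edge table, kernel form (`2048` bits). -/
def bits11 (T : (Fin 11 → Bool) → Bool) : ℕ := goB T 11 (fun _ => false)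

/-- **The table literals of a triple are correct**: `L i a b` is the bit vector of the restriction of the
`i`-th table of the triple to edges `11 ↦ a`, `12 ↦ b`. -/
def LitOK (x y z : Fin 5) (L : Fin 19 → Bool → Bool → ℕ) : Prop :=
  ∀ (i : Fin 19) (a b : Bool), L i a b = bits11 (res2 (tab x y z i) a b)

/-! ## Kronecker numbers on eleven edges, from a bit vector -/

/-- The base-4 index of an eleven-edge configuration: digit `e` is the state of edge `e`. -/
def idx (ω : Fin 11 → Bool) : ℕ := ∑ e, (ω e).toNat * 4 ^ (e : ℕ)

/-- The Kronecker base `2^24` (a slice digit is a sum of at most `90` counts `≤ 3^11`, so `< 2^24`). -/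
def KB : ℕ := 2 ^ 24

/-- The Kronecker encoding of a Boolean table on the eleven-edge configurations, as a finite sum. -/
def kronSum (T : (Fin 11 → Bool) → Bool) : ℕ := ∑ ω, (T ω).toNat * KB ^ idx ω

/-- The same number by a binary tree over the edges `10, 9, …, 0` (`go T n ω` sums over the states of the
edges `< n`, the others fixed by `ω`): `go T (n+1) ω = go T n ω[n ↦ 0] + KB^{4^n} · go T n ω[n ↦ 1]`. -/
def go (T : (Fin 11 → Bool) → Bool) : ℕ → (Fin 11 → Bool) → ℕ
  | 0, ω => (T ω).toNat
  | n + 1, ω => go T n (Function.update ω (Fin.ofNat 11 n) false) +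
      KB ^ (4 ^ n) * go T n (Function.update ω (Fin.ofNat 11 n) true)

/-- The Kronecker encoding, kernel form: `kron T = go T 11 (fun _ => false)`. -/
def kron (T : (Fin 11 → Bool) → Bool) : ℕ := go T 11 (fun _ => false)

/-- **The Kronecker number of a bit-vector table, by the index-carrying tree**: `goL L n i` sums, over the
states of the edges `< n` (the bits of `i` carry the fixed ones), `[bit (i + idx2 s) of L] · KB^{idx s}` —
a leaf is one `Nat.testBit`, so the kernel computes these numbers from the table literals with no
configuration lookups at all. -/
def goL (L : ℕ) : ℕ → ℕ → ℕ
  | 0, i => (L.testBit i).toNat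
  | n + 1, i => goL L n i + KB ^ (4 ^ n) * goL L n (i + 2 ^ n)

/-- The Kronecker number of the table with bit vector `L`. -/
def kronL (L : ℕ) : ℕ := goL L 11 0

/-- The mask: bit `23` of every base-`KB` digit below `4^11`. -/
def mask : ℕ := 2 ^ 23 * ((KB ^ (4 ^ 11) - 1) / (KB - 1))

/-! ## The slices: profile digits `j₁` of edge `11` and `j₂` of edge `12` -/

/-- The ways to write the digit `j` as a sum of three bits `(a, b, c)` (the states of the edge in the three
copies). -/
def splits3 : ℕ → List (Bool × Bool × Bool)
  | 0 => [(false, false, false)]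
  | 1 => [(true, false, false), (false, true, false), (false, false, true)]
  | 2 => [(true, true, false), (true, false, true), (false, true, true)]
  | 3 => [(true, true, true)]
  | _ => []

/-- The ways to complete the bit `a` to the digit `j` by two bits `(b, c)`: `a + b + c = j`. -/
def pairs2 : ℕ → Bool → List (Bool × Bool)
  | 0, false => [(false, false)]
  | 1, false => [(true, false), (false, true)]
  | 1, true => [(false, false)]
  | 2, false => [(true, true)]
  | 2, true => [(true, false), (false, true)]
  | 3, true => [(true, true)]
  | _, _ => []

/-- The Kronecker number of the `i`-th table restricted to `(a, b)`, from the literals `L`. -/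
def KL (L : Fin 19 → Bool → Bool → ℕ) (i : Fin 19) (a b : Bool) : ℕ := kronL (L i a b)

/-- The Kronecker number of the two-table sum `S₁ = t4p + t6m` of the positive `PD`-group, restricted (`a` = edge
`11`, `b` = edge `12`). -/
def S1 (L : Fin 19 → Bool → Bool → ℕ) (a b : Bool) : ℕ := KL L 3 a b + KL L 8 a b
/-- `S₂ = t7m0 + t10p` (positive `PD`-group), restricted. -/
def S2 (L : Fin 19 → Bool → Bool → ℕ) (a b : Bool) : ℕ := KL L 12 a b + KL L 15 a b
/-- `S₃ = t7p0 + t10m` (positive `PD`-group), restricted. -/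
def S3 (L : Fin 19 → Bool → Bool → ℕ) (a b : Bool) : ℕ := KL L 11 a b + KL L 16 a b

/-- `S₁′ = t4m + t6p + t11` (negative `PD`-group), restricted. -/
def S1' (L : Fin 19 → Bool → Bool → ℕ) (a b : Bool) : ℕ := KL L 4 a b + KL L 7 a b + KL L 17 a b
/-- `S₂′ = t7p0 + t10m` (negative `PD`-group), restricted. -/
def S2' (L : Fin 19 → Bool → Bool → ℕ) (a b : Bool) : ℕ := KL L 11 a b + KL L 16 a b
/-- `S₃′ = t7m0 + t10p` (negative `PD`-group), restricted. -/
def S3' (L : Fin 19 → Bool → Bool → ℕ) (a b : Bool) : ℕ := KL L 12 a b + KL L 15 a b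

/-- The inner sum of a group at the first factor's bits `(a₁, a₂)`: the bracket `f` (of the second and third
factors' bits `(b₁, c₁)` of edge `11` and `(b₂, c₂)` of edge `12`) summed over the completions of `(a₁, a₂)`
to the digits `(j₁, j₂)` — the sum over edge `12` outside, edge `11` inside. -/
def inner (j₁ j₂ : ℕ) (a₁ a₂ : Bool) (f : Bool × Bool → Bool × Bool → ℕ) : ℕ :=
  ((pairs2 j₂ a₂).map fun bc₂ => ((pairs2 j₁ a₁).map fun bc₁ => f bc₁ bc₂).sum).sum

/-- The positive `PD`-group bracket: `Q_b S₁_c + t7p4_b S₂_c + t7m4_b S₃_c` (monomials 1, 3, 4, 8, 5, 9). -/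
def brPosPD (L : Fin 19 → Bool → Bool → ℕ) (bc₁ bc₂ : Bool × Bool) : ℕ :=
  KL L 0 bc₁.1 bc₂.1 * S1 L bc₁.2 bc₂.2 + KL L 9 bc₁.1 bc₂.1 * S2 L bc₁.2 bc₂.2 +
    KL L 10 bc₁.1 bc₂.1 * S3 L bc₁.2 bc₂.2

/-- The positive `PDoU`-group bracket: `t7p4_b t7m5_c + t7m4_b t7p5_c` (monomials 6, 7). -/
def brPosPDoU (L : Fin 19 → Bool → Bool → ℕ) (bc₁ bc₂ : Bool × Bool) : ℕ :=
  KL L 9 bc₁.1 bc₂.1 * KL L 14 bc₁.2 bc₂.2 + KL L 10 bc₁.1 bc₂.1 * KL L 13 bc₁.2 bc₂.2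

/-- The positive `Q`-group bracket: `PDoU_b t5p_c + t12_b PDoU_c` (monomials 2, 10; factor orders kept). -/
def brPosQ (L : Fin 19 → Bool → Bool → ℕ) (bc₁ bc₂ : Bool × Bool) : ℕ :=
  KL L 2 bc₁.1 bc₂.1 * KL L 5 bc₁.2 bc₂.2 + KL L 18 bc₁.1 bc₂.1 * KL L 2 bc₁.2 bc₂.2

/-- The negative `PD`-group bracket: `Q_b S₁′_c + t7p4_b S₂′_c + t7m4_b S₃′_c` (monomials 1′, 3′, 10′, 4′, 8′, 5′, 9′). -/
def brNegPD (L : Fin 19 → Bool → Bool → ℕ) (bc₁ bc₂ : Bool × Bool) : ℕ :=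
  KL L 0 bc₁.1 bc₂.1 * S1' L bc₁.2 bc₂.2 + KL L 9 bc₁.1 bc₂.1 * S2' L bc₁.2 bc₂.2 +
    KL L 10 bc₁.1 bc₂.1 * S3' L bc₁.2 bc₂.2

/-- The negative `PDoU`-group bracket: `t7p4_b t7p5_c + t7m4_b t7m5_c` (monomials 6′, 7′). -/
def brNegPDoU (L : Fin 19 → Bool → Bool → ℕ) (bc₁ bc₂ : Bool × Bool) : ℕ :=
  KL L 9 bc₁.1 bc₂.1 * KL L 13 bc₁.2 bc₂.2 + KL L 10 bc₁.1 bc₂.1 * KL L 14 bc₁.2 bc₂.2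

/-- The negative `Q`-group bracket: `PDoU_b t5m_c` (monomial 2′). -/
def brNegQ (L : Fin 19 → Bool → Bool → ℕ) (bc₁ bc₂ : Bool × Bool) : ℕ :=
  KL L 2 bc₁.1 bc₂.1 * KL L 6 bc₁.2 bc₂.2

/-- The two states of a bit, for the outer sums. -/
def bools : List Bool := [false, true]

/-- **The positive slice number**: the Kronecker number of the positive counts of `K₃` at the profiles whose
edge-`11` digit is `j₁` and edge-`12` digit is `j₂`, grouped by the first factor:
`Σ_{a₂ a₁} PD_{a₁a₂} · inner brPosPD + PDoU_{a₁a₂} · inner brPosPDoU + Q_{a₁a₂} · inner brPosQ`. -/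
def kPosS (L : Fin 19 → Bool → Bool → ℕ) (j₁ j₂ : ℕ) : ℕ :=
  (bools.map fun a₂ => (bools.map fun a₁ =>
    KL L 1 a₁ a₂ * inner j₁ j₂ a₁ a₂ (brPosPD L) + KL L 2 a₁ a₂ * inner j₁ j₂ a₁ a₂ (brPosPDoU L) +
      KL L 0 a₁ a₂ * inner j₁ j₂ a₁ a₂ (brPosQ L)).sum).sum

/-- **The negative slice number**, grouped the same way. -/
def kNegS (L : Fin 19 → Bool → Bool → ℕ) (j₁ j₂ : ℕ) : ℕ :=
  (bools.map fun a₂ => (bools.map fun a₁ =>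
    KL L 1 a₁ a₂ * inner j₁ j₂ a₁ a₂ (brNegPD L) + KL L 2 a₁ a₂ * inner j₁ j₂ a₁ a₂ (brNegPDoU L) +
      KL L 0 a₁ a₂ * inner j₁ j₂ a₁ a₂ (brNegQ L)).sum).sum

/-- **The slice certificate shape**: `kNegS ≤ kPosS` and the two mask tests (no borrow anywhere, digits of
`kNegS` below `2^23`). -/
def CertS (L : Fin 19 → Bool → Bool → ℕ) (j₁ j₂ : ℕ) : Prop :=
  kNegS L j₁ j₂ ≤ kPosS L j₁ j₂ ∧ Nat.land (kPosS L j₁ j₂ - kNegS L j₁ j₂) mask = 0 ∧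
    Nat.land (kNegS L j₁ j₂) mask = 0

/-- **All sixteen slices**: the certificate of a table family. -/
def Cert (L : Fin 19 → Bool → Bool → ℕ) : Prop := ∀ j₁ j₂ : Fin 4, CertS L j₁ j₂

end Deg3

end Summit.Ventures.PercRepro2
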